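import Summits.ValiantsHypothesis.ValiantsHypothesis.Theses.ElementaryWordLength
import Summits.ValiantsHypothesis.ValiantsHypothesis.Theorems.ElementaryWordLengthWordPerCubicStubSegmentSubalgebra
import Summits.ValiantsHypothesis.ValiantsHypothesis.Theorems.ElementaryWordLengthWordPerCubicStubPairAlgIndependent
import Summits.ValiantsHypothesis.ValiantsHypothesis.Theorems.ElementaryWordLengthWordPerCubicStubBlockSum
import Summits.ValiantsHypothesis.ValiantsHypothesis.Theorems.ElementaryWordLengthWordPerCubicStubCardLeOfAlgebraicIndependent
import Summits.ValiantsHypothesis.ValiantsHypothesis.Theorems.ElementaryWordLengthWordPerCubicStubPerPairCoeff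
import Summits.ValiantsHypothesis.ValiantsHypothesis.Theorems.ElementaryWordLengthWordPerCubicStubCubicArithmetic

/-!
# Line `Sketch` (idea `segment-jacobian`) — skeleton for crux `ElementaryWordLength.WordPerCubic`
# (stmt-ValiantsHypothesis-6625; route ElementaryWordLength, decl `WordPerCubic`)

Crux (by name): `Summit.ValiantsHypothesis.ValiantsHypothesis.Theses.ElementaryWordLength.WordPerCubic` —
for some `c > 0` and all large `n`, every affine elementary word for `E_02(per_n)` in `E_3(ℂ[x_11..x_nn])`
has length `≥ c·n³` (here: `c = 1/36`, `n₀ = 8`).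

## The line (idea card `Cruxes/WordPerCubic/Ideas/segment-jacobian.md`): Kalorkoti's count in the word model

LEVER. Fix the shifted transversal block `B_k = {(c + k, c) : c ∈ Fin n}` of variables (per's convention is
`per = Σ_π ∏_c X(π c, c)`, so `(r, c) ∈ B_k ↔ r = c + k`).  Split variables with the algebra map
`φ_k : ℂ[x] → (ℂ[x])[x_B]`, `X v ↦ X v` (outer variable) if `v ∈ B_k`, `X v ↦ C (X v)` (coefficient) otherwise.
A word with `ℓ_k` letters carrying a `B_k`-variable factors as `M₀ E₁ M₁ ⋯ E_ℓ M_ℓ` with `B_k`-free segments `M_t`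
(3 × 3 matrices of coefficients): every coefficient (w.r.t. the outer variables) of every entry of the mapped
product lies in the `ℂ`-subalgebra of `ℂ[x]` generated by the `≤ 9(ℓ_k + 1)` segment entries (S1).  In a
subalgebra generated by `q` elements an algebraically independent family has `≤ q` members (S2, transcendence
degree of `ℂ[T_1..T_q]`).  For `per_n` the coefficient of the monomial `∏_{c ∉ {a,b}} X(c+k, c)` is the single
2-derangement term `X(b+k, a)·X(a+k, b)` (S3), and over the pairs `a < b` these `n(n-1)/2` products of pairwise
disjoint variables are algebraically independent (S4).  Hence `n(n-1)/2 ≤ 9(ℓ_k + 1)` for each of the `n`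
disjoint blocks, `Σ_k ℓ_k ≤ |w|` (S5), and the arithmetic `|w| ≥ n·(n(n-1)/18 − 1) ≥ n³/36` for `n ≥ 8` (S6).

RESHAPE relative to the ideator's Sketch.lean (same lever, same composition): the Jacobian-at-a-point certificate
(JacobianBound + PairGradientIndependent) is replaced by the card's listed fallback (A) — Mathlib's transcendence
degree (`AlgebraicIndependent.cardinalMk_le_trdeg`, `MvPolynomial.trdeg_of_isDomain`), which is one lemma here;
and the variable split is the explicit `MvPolynomial.aeval` above (coefficient ring = the full `ℂ[x]`, no subtypes)
instead of `sumAlgEquiv ∘ rename (Equiv.sumCompl _)`.  No new definition, no Literature fact, Mathlib only.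

COMPOSITION (`WordPerCubic_of`, sorry-free apart from the stubs): S1 `stub_segmentSubalgebra` → S2
`stub_card_le_of_algebraicIndependent` ← (S3 `stub_perPairCoeff`, S4 `stub_pairAlgIndependent`) gives
`card {a < b} ≤ 9(ℓ_k + 1)` per block; S5 `stub_blockSum` and S6 `stub_cubicArithmetic` finish.

## Disproof.lean used

None exists yet for this crux (`ledger crux ls stmt-ValiantsHypothesis-6625`: only `Ideas/segment-jacobian.md`,
2026-08-16T11:45Z; payload `disproof_path` not mounted).  The line uses every hypothesis of the crux except
`∀ l ∈ w, l.1 ≠ l.2.1` (idle for the lower bound: a diagonal "letter" `1 + c·e_ii` is still a matrix of the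
right shape for S1) — recorded, not a defect: the bound holds for the larger class of words.
-/

noncomputable section

-- `Summit.ValiantsHypothesis.ValiantsHypothesis.…` is the tree's mandated single-conjunct layout.
set_option linter.dupNamespace false

namespace Summit.ValiantsHypothesis.ValiantsHypothesis.Cruxes.WordPerCubic.SegmentJacobian

open Literature.Computability.AlgebraicComplexity MvPolynomial

/-! ## Stubs (registered; each is proved as stated by one worker or by the lead) -/

/-- S1 — **segment subalgebra** (the word-side engine; held by the lead).  For a block predicate `p` on the
variables and ANY list of letters, all coefficients (w.r.t. the block variables) of all entries of the
block-split product lie in a subalgebra of `ℂ[x]` generated by at most `9·(ℓ_p + 1)` elements, `ℓ_p` the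
number of letters carrying a `p`-variable (the entries of the `p`-free segments). -/
theorem stub_segmentSubalgebra {σ : Type} [DecidableEq σ] (p : σ → Prop) [DecidablePred p]
    (w : List (Fin 3 × Fin 3 × ℂ × Option σ)) :
    ∃ s : Finset (MvPolynomial σ ℂ),
      s.card ≤ 9 * (w.countP (fun l => l.2.2.2.any (fun v => decide (p v))) + 1) ∧
      ∀ (i j : Fin 3) (m : σ →₀ ℕ),
        coeff m ((((w.map (fun l => Matrix.transvection l.1 l.2.1
          (C l.2.2.1 * l.2.2.2.elim 1 X))).prod).map
          (aeval (fun v : σ => if p v then (X v : MvPolynomial σ (MvPolynomial σ ℂ))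
            else C (X v)))) i j) ∈ Algebra.adjoin ℂ (↑s : Set (MvPolynomial σ ℂ)) :=
  -- LANDED (lead, p102814): Theorems/ElementaryWordLengthWordPerCubicStubSegmentSubalgebra.lean
  Summit.ValiantsHypothesis.ValiantsHypothesis.Theorems.ElementaryWordLengthWordPerCubic.stub_segmentSubalgebra p w

/-- S2 — **transcendence count**: an algebraically independent family inside the subalgebra generated by
a finite set `s` has at most `|s|` members (`trdeg ℂ ℂ[T_s] = |s|`). -/
theorem stub_card_le_of_algebraicIndependent {ι τ : Type} [Fintype ι]
    (s : Finset (MvPolynomial τ ℂ)) (c : ι → MvPolynomial τ ℂ)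
    (hc : AlgebraicIndependent ℂ c)
    (hmem : ∀ i, c i ∈ Algebra.adjoin ℂ (↑s : Set (MvPolynomial τ ℂ))) :
    Fintype.card ι ≤ s.card :=
  -- LANDED (wave 1, p102481): Theorems/ElementaryWordLengthWordPerCubicStubCardLeOfAlgebraicIndependent.lean
  Summit.ValiantsHypothesis.ValiantsHypothesis.Theorems.ElementaryWordLengthWordPerCubic.stub_card_le_of_algebraicIndependent
    s c hc hmem

/-- S3 — **per's 2-derangement coefficients**: against the block `B_k = {(c + k, c)}`, the coefficient in
`per_n = Σ_π ∏_c X(π c, c)` of the block monomial `∏_{c ∉ {a, b}} X(c + k, c)` is the single term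
`X(b + k, a)·X(a + k, b)` (the unique permutation with `{c | π c = c + k} = {a, b}ᶜ`). -/
theorem stub_perPairCoeff (n : ℕ) (k a b : Fin n) (hab : a ≠ b) :
    coeff (∑ c ∈ ({a, b} : Finset (Fin n))ᶜ, Finsupp.single (c + k, c) 1)
      (aeval (fun v : Fin n × Fin n => if v.1 = v.2 + k
        then (X v : MvPolynomial (Fin n × Fin n) (MvPolynomial (Fin n × Fin n) ℂ))
        else C (X v)) (perPoly (Fin n) ℂ)) = X (b + k, a) * X (a + k, b) :=
  -- LANDED (wave 1, p102776): Theorems/ElementaryWordLengthWordPerCubicStubPerPairCoeff.lean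
  Summit.ValiantsHypothesis.ValiantsHypothesis.Theorems.ElementaryWordLengthWordPerCubic.stub_perPairCoeff n k a b hab

/-- S4 — **independence of the pair products**: the `n(n-1)/2` products `X(b + k, a)·X(a + k, b)`,
`a < b`, of pairwise disjoint pairs of variables are algebraically independent over `ℂ`. -/
theorem stub_pairAlgIndependent (n : ℕ) (k : Fin n) :
    AlgebraicIndependent ℂ (fun e : {e : Fin n × Fin n // e.1 < e.2} =>
      (X (e.1.2 + k, e.1.1) * X (e.1.1 + k, e.1.2) : MvPolynomial (Fin n × Fin n) ℂ)) :=
  -- LANDED (wave 1, p102078): Theorems/ElementaryWordLengthWordPerCubicStubPairAlgIndependent.lean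
  Summit.ValiantsHypothesis.ValiantsHypothesis.Theorems.ElementaryWordLengthWordPerCubic.stub_pairAlgIndependent n k

/-- S5 — **blocks partition the letters**: a letter carries a variable of at most one block `B_k`
(`(r, c) ∈ B_k ↔ k = r - c`), so the block letter counts sum to at most the length. -/
theorem stub_blockSum (n : ℕ) (w : List (Fin 3 × Fin 3 × ℂ × Option (Fin n × Fin n))) :
    ∑ k : Fin n, w.countP (fun l => l.2.2.2.any (fun v => decide (v.1 = v.2 + k))) ≤ w.length :=
  -- LANDED (wave 1, p102076): Theorems/ElementaryWordLengthWordPerCubicStubBlockSum.lean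
  Summit.ValiantsHypothesis.ValiantsHypothesis.Theorems.ElementaryWordLengthWordPerCubic.stub_blockSum n w

/-- S6 — **arithmetic**: `card {a < b} = n(n-1)/2 ≤ 9(ℓ_k + 1)` for all `k` and `Σ_k ℓ_k ≤ L` give
`n³/36 ≤ L` once `n ≥ 8`. -/
theorem stub_cubicArithmetic (n : ℕ) (hn : 8 ≤ n) (L : ℕ) (ℓ : Fin n → ℕ)
    (hℓ : ∀ k, Fintype.card {e : Fin n × Fin n // e.1 < e.2} ≤ 9 * (ℓ k + 1))
    (hsum : ∑ k, ℓ k ≤ L) : (1 / 36 : ℝ) * (n : ℝ) ^ 3 ≤ (L : ℝ) :=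
  -- LANDED (wave 1, p102800): Theorems/ElementaryWordLengthWordPerCubicStubCubicArithmetic.lean
  Summit.ValiantsHypothesis.ValiantsHypothesis.Theorems.ElementaryWordLengthWordPerCubic.stub_cubicArithmetic n hn L ℓ hℓ hsum

/-! ## Composition: the line concludes the crux BY NAME (modulo the stubs) -/

/-- The `(0,2)` entry of a mapped transvection `E_02(f)` is the image of `f`. -/
theorem map_transvection_apply_02 {R S : Type} [CommRing R] [CommRing S] (f : R → S) (x : R) :
    ((Matrix.transvection (0 : Fin 3) 2 x).map f) 0 2 = f x := by
  simp [Matrix.transvection, Matrix.map_apply, Matrix.add_apply, Matrix.single]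

/-- **The line concludes the crux** `ElementaryWordLength.WordPerCubic` with `c = 1/36`, `n₀ = 8`:
per block, S1 + S3 put the pair products inside a subalgebra with `≤ 9(ℓ_k + 1)` generators, S4 + S2
bound their number `n(n-1)/2` by that, and S5 + S6 sum over the `n` blocks. -/
theorem WordPerCubic_of :
    Summit.ValiantsHypothesis.ValiantsHypothesis.Theses.ElementaryWordLength.WordPerCubic := by
  refine ⟨1 / 36, by norm_num, 8, fun n hn L hex => ?_⟩
  obtain ⟨w, hlen, _hw, hprod⟩ := hex
  have hblock : ∀ k : Fin n, Fintype.card {e : Fin n × Fin n // e.1 < e.2} ≤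
      9 * (w.countP (fun l => l.2.2.2.any (fun v => decide (v.1 = v.2 + k))) + 1) := by
    intro k
    obtain ⟨s, hs, hcoef⟩ := stub_segmentSubalgebra (fun v : Fin n × Fin n => v.1 = v.2 + k) w
    refine le_trans (stub_card_le_of_algebraicIndependent s _ (stub_pairAlgIndependent n k) ?_) hs
    intro e
    have h02 := hcoef 0 2 (∑ c ∈ ({e.1.1, e.1.2} : Finset (Fin n))ᶜ, Finsupp.single (c + k, c) 1)
    rw [hprod, map_transvection_apply_02,
      stub_perPairCoeff n k e.1.1 e.1.2 (ne_of_lt e.2)] at h02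
    exact h02
  exact stub_cubicArithmetic n hn L _ hblock (le_trans (stub_blockSum n w) hlen)

end Summit.ValiantsHypothesis.ValiantsHypothesis.Cruxes.WordPerCubic.SegmentJacobian

end
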